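import Summits.Langlands.Langlands.Theses.DyadicOddResidue
import Literature.RepresentationTheory.Semisimple.BurnsideMatrixSpan

/-!
# `DyadicEisensteinFM` (stmt-Langlands-18741) — knowledge IV on the residual hypothesis: a trace
# criterion for the Eisenstein residue (`tr ρ ≡ const (mod 𝔪)` ⟹ `ρ̄` not absolutely irreducible)

Support lemmas of the standing disprover (`Cruxes/DyadicEisensteinFM/Disproof.lean`, cycle 1,
§1b; refuter-cdisprove-stmt-Langlands-18741-0, 2026-08-17), on the hypothesis
`¬ ρ.IsResiduallyAbsIrreducible` (`hres`) of
`Summit.Langlands.Langlands.Theses.DyadicOddResidue.DyadicEisensteinFM`.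

* `eq_one_of_isAbsIrreducible_of_trace_const` — **Burnside–Kolchin**: an absolutely irreducible
  `τ : G → GL_n(k)` (`n ≥ 1`, any field `k`) with CONSTANT trace is trivial.  (For `u = τ(g₀)`,
  the functional `M ↦ tr((u - 1)M)` kills every `τ(g)` since `tr τ(g₀g) = tr τ(g)`, hence kills
  the `k`-span of `τ(G)`, which is all of `M_n(k)` by Burnside's theorem (the tree's
  `span_eq_top_iff_forall_isIrreducible`); so `u = 1`.)
* `not_isAbsIrreducible_of_trace_const` — hence for `n ≥ 2` a representation with constant trace
  is NOT absolutely irreducible (the span of the trivial representation is the line `k·1`, which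
  misses the elementary matrix `E₀₁`).
* `trace_reduction` — the trace of a reduction is the reduction of the trace (`IsReductionOf`).
* `not_isResiduallyAbsIrreducible_of_trace_sub_mem` — **trace criterion for `hres`**: if
  `tr ρ(g) ≡ c (mod 𝔪_{ℤ̄_ℓ})` for one constant `c` and all `g` (witnessed integrally), then
  `ρ : Γ_K → GL₂(ℚ̄_ℓ)` is NOT residually absolutely irreducible.  At `ℓ = 2` the constant is
  forced to be `tr 1 = 2 ≡ 0`, and the criterion reads "`tr ρ(g) ∈ 𝔪` for all `g`", i.e.
  `ρ̄^ss = χ̄ ⊕ χ̄` — the most degenerate Eisenstein residue, met by `ρ_{Δ,2}` (`τ(p) ≡ 1 + p¹¹ ≡ 0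
  (mod 2)` for odd `p`, plus Chebotarev and continuity) and by every `ρ_{f,2}` with `a_p(f)` even
  for all odd `p`: these representations are in the scope of the crux by a trace congruence alone
  (non-vacuity of `hres` on the modular locus, pen-and-paper part: the congruence; typed part:
  this file).

Nothing here asserts a route statement. [folklore]
-/

set_option linter.dupNamespace false -- project-wide option; `Summit.Langlands.Langlands` is the mandated namespace

noncomputable section

open scoped MatrixGroups
open Matrix
open Literature.NumberTheory.GaloisRepresentations

namespace Summit.Langlands.Langlands.Theorems.DyadicEisensteinFM.Negative

universe u

section Burnside

variable {k : Type u} [Field k] {G : Type*} [Group G] {n : ℕ}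

/-- For `τ : G → GL_n(k)` with constant trace and `u = τ(g₀)`, the functional `M ↦ tr((u - 1)M)`
vanishes on the `k`-span of `τ(G)` (on generators: `tr(u τ(g)) - tr(τ(g)) = tr τ(g₀g) - tr τ(g)
= 0`). [folklore] -/
theorem trace_sub_one_mul_eq_zero_of_trace_const (τ : G →* GL (Fin n) k) (c : k)
    (htr : ∀ g, ((τ g : GL (Fin n) k) : Matrix (Fin n) (Fin n) k).trace = c) (g₀ : G)
    (M : Matrix (Fin n) (Fin n) k)
    (hM : M ∈ Submodule.span k
      (Set.range fun g => ((τ g : GL (Fin n) k) : Matrix (Fin n) (Fin n) k))) :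
    ((((τ g₀ : GL (Fin n) k) : Matrix (Fin n) (Fin n) k) - 1) * M).trace = 0 := by
  induction hM using Submodule.span_induction with
  | mem x hx =>
    obtain ⟨g, rfl⟩ := hx
    rw [sub_mul, one_mul, Matrix.trace_sub, ← Matrix.GeneralLinearGroup.coe_mul, ← map_mul, htr,
      htr, sub_self]
  | zero => rw [mul_zero, Matrix.trace_zero]
  | add x y _ _ hx hy => rw [mul_add, Matrix.trace_add, hx, hy, add_zero]
  | smul a x _ hx => rw [Matrix.mul_smul, Matrix.trace_smul, hx, smul_zero]

/-- **Burnside–Kolchin: an absolutely irreducible representation with constant trace is trivial.**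
For `n ≥ 1`, `τ : G → GL_n(k)` absolutely irreducible (`IsAbsIrreducible`) and `tr τ(g) = c` for
all `g`: `τ(g₀) = 1` for every `g₀` (the functional `M ↦ tr((τ(g₀) - 1)M)` vanishes on
`k⟨τ(G)⟩ = M_n(k)`, Burnside, so `τ(g₀) - 1 = 0` by non-degeneracy of the trace pairing, Mathlib
`Matrix.ext_iff_trace_mul_right`). [folklore] -/
theorem eq_one_of_isAbsIrreducible_of_trace_const (hn : 0 < n) (τ : G →* GL (Fin n) k)
    (habs : IsAbsIrreducible τ) (c : k)
    (htr : ∀ g, ((τ g : GL (Fin n) k) : Matrix (Fin n) (Fin n) k).trace = c) (g₀ : G) :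
    τ g₀ = 1 := by
  have hspan := (Literature.RepresentationTheory.Semisimple.span_eq_top_iff_forall_isIrreducible
    hn τ).2 habs
  have hu : ((τ g₀ : GL (Fin n) k) : Matrix (Fin n) (Fin n) k) - 1 = 0 := by
    refine Matrix.ext_iff_trace_mul_right.2 fun x => ?_
    rw [zero_mul, Matrix.trace_zero]
    exact trace_sub_one_mul_eq_zero_of_trace_const τ c htr g₀ x
      (by rw [hspan]; exact Submodule.mem_top)
  exact Units.ext (by rw [Units.val_one]; exact sub_eq_zero.mp hu)

/-- **A representation of dimension `≥ 2` with constant trace is not absolutely irreducible**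
(by the previous theorem it would be trivial, but the span of the trivial representation is the
line `k · 1`, which does not contain the elementary matrix `E₀₁`, contradicting Burnside).
[folklore] -/
theorem not_isAbsIrreducible_of_trace_const (hn : 2 ≤ n) (τ : G →* GL (Fin n) k) (c : k)
    (htr : ∀ g, ((τ g : GL (Fin n) k) : Matrix (Fin n) (Fin n) k).trace = c) :
    ¬ IsAbsIrreducible τ := by
  intro habs
  have hn0 : 0 < n := by omega
  have h1 : ∀ g, τ g = 1 := eq_one_of_isAbsIrreducible_of_trace_const hn0 τ habs c htr
  have hspan := (Literature.RepresentationTheory.Semisimple.span_eq_top_iff_forall_isIrreducible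
    hn0 τ).2 habs
  have hle : Submodule.span k (Set.range fun g => ((τ g : GL (Fin n) k) : Matrix (Fin n) (Fin n) k))
      ≤ k ∙ (1 : Matrix (Fin n) (Fin n) k) := by
    refine Submodule.span_le.2 ?_
    rintro _ ⟨g, rfl⟩
    simp only [h1 g, Units.val_one]
    exact Submodule.mem_span_singleton_self _
  let i : Fin n := ⟨0, by omega⟩
  let j : Fin n := ⟨1, by omega⟩
  have hij : i ≠ j := by simp [i, j, Fin.ext_iff]
  have hmem : Matrix.single i j (1 : k) ∈ k ∙ (1 : Matrix (Fin n) (Fin n) k) :=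
    hle (by rw [hspan]; exact Submodule.mem_top)
  obtain ⟨a, ha⟩ := Submodule.mem_span_singleton.1 hmem
  have h := congr_fun (congr_fun ha i) j
  simp [hij] at h

end Burnside

section Reduction

variable {F : Type*} [Field F] {O : ValuationSubring F} {n : ℕ} {G : Type*} [Group G]
  {k : Type*} [Field k]

/-- **The trace of a reduction is the reduction of the trace**: if `τ` is a reduction of
`ρ : G → GL_n(F)` along `ι : O/𝔪 →+* k` (`τ = Q (ρ₀ mod 𝔪) Q⁻¹`, `ρ₀ = P⁻¹ ρ P` integral), then for
every `g` there is `t ∈ O` (namely `tr ρ₀(g)`) with `t = tr ρ(g)` in `F` and `tr τ(g) = ι(t mod 𝔪)`.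
[folklore] -/
theorem trace_reduction {ι : IsLocalRing.ResidueField O →+* k} {ρ : G →* GL (Fin n) F}
    {τ : G →* GL (Fin n) k}
    (h : Literature.NumberTheory.GaloisRepresentations.IsReductionOf ι ρ τ) (g : G) :
    ∃ t : O, (t : F) = ((ρ g : GL (Fin n) F) : Matrix (Fin n) (Fin n) F).trace ∧
      ((τ g : GL (Fin n) k) : Matrix (Fin n) (Fin n) k).trace = ι (IsLocalRing.residue O t) := by
  obtain ⟨ρ₀, Q, ⟨P, hP⟩, hQ⟩ := h
  refine ⟨((ρ₀ g : GL (Fin n) O) : Matrix (Fin n) (Fin n) O).trace, ?_, ?_⟩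
  · have h1 : O.subtype (((ρ₀ g : GL (Fin n) O) : Matrix (Fin n) (Fin n) O).trace) =
        ((Matrix.GeneralLinearGroup.map O.subtype (ρ₀ g) : GL (Fin n) F) :
          Matrix (Fin n) (Fin n) F).trace := by
      rw [AddMonoidHom.map_trace]
      rfl
    rw [ValuationSubring.subtype_apply] at h1
    rw [h1, hP g, Matrix.GeneralLinearGroup.coe_mul, Matrix.GeneralLinearGroup.coe_mul,
      Matrix.trace_units_conj']
  · rw [hQ g, Matrix.GeneralLinearGroup.coe_mul, Matrix.GeneralLinearGroup.coe_mul,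
      Matrix.trace_units_conj]
    change ((Matrix.GeneralLinearGroup.map (ι.comp (IsLocalRing.residue O)) (ρ₀ g) :
      GL (Fin n) k) : Matrix (Fin n) (Fin n) k).trace = _
    rw [← RingHom.comp_apply ι (IsLocalRing.residue O), AddMonoidHom.map_trace]
    rfl

/-- **Trace criterion for the residual hypothesis `hres`.**  If the traces of
`ρ : Γ_K → GL₂(ℚ̄_ℓ)` are congruent modulo `𝔪 = 𝔪_{ℤ̄_ℓ}` to one constant `c` — integrally
witnessed: for every `g` some `t ∈ ℤ̄_ℓ` has `t = tr ρ(g)` and `t - c ∈ 𝔪` — then NO reduction of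
`ρ` is absolutely irreducible, i.e. `¬ ρ.IsResiduallyAbsIrreducible` (every reduction has constant
trace `c̄`, `trace_reduction`; apply `not_isAbsIrreducible_of_trace_const`).  At `ℓ = 2` take
`c = 0`: "`tr ρ(g) ∈ 𝔪` for all `g`" puts `ρ` in the scope of `DyadicEisensteinFM`'s residual
hypothesis (`ρ̄^ss = χ̄ ⊕ χ̄`; e.g. `ρ_{Δ,2}`). [folklore] -/
theorem not_isResiduallyAbsIrreducible_of_trace_sub_mem {K : Type*} [Field K] {ℓ : ℕ}
    [Fact ℓ.Prime] (ρ : FramedGaloisRep K (PadicAlgCl ℓ) 2) (c : padicAlgClIntegers ℓ)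
    (h : ∀ g : Field.absoluteGaloisGroup K, ∃ t : padicAlgClIntegers ℓ,
      (t : PadicAlgCl ℓ) = ((ρ g : GL (Fin 2) (PadicAlgCl ℓ)) : Matrix (Fin 2) (Fin 2) _).trace ∧
        t - c ∈ IsLocalRing.maximalIdeal (padicAlgClIntegers ℓ)) :
    ¬ ρ.IsResiduallyAbsIrreducible := by
  rintro ⟨τ, hτ, habs⟩
  refine not_isAbsIrreducible_of_trace_const le_rfl τ
    (IsLocalRing.residue (padicAlgClIntegers ℓ) c) (fun g => ?_) habs
  obtain ⟨t, ht, hτt⟩ := trace_reduction hτ g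
  obtain ⟨t', ht', hmem⟩ := h g
  have htt : t = t' := Subtype.val_injective (ht.trans ht'.symm)
  rw [hτt, RingHom.id_apply, htt]
  rw [← sub_eq_zero, ← map_sub]
  exact (IsLocalRing.residue_eq_zero_iff _).2 hmem

end Reduction

end Summit.Langlands.Langlands.Theorems.DyadicEisensteinFM.Negative

end
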